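import Literature.MathematicalPhysics.QuantumFieldTheory.Balaban1983to89.Node00.OpsYGauge
import Literature.MathematicalPhysics.QuantumFieldTheory.Balaban1983to89.B9Thm311PositivityKnitLetter

/-!
# `Balaban1983to89.B9B8KnitLetterTau` — [B9] pp. 389–390, [B8] p. 76: THE LETTERS ACT ON `𝔤`-VALUED FUNCTIONS. Every letter of def-Y's family —
# `Δ′_a(U)`, `Q′(U)`, `Q′*(U)`, `G′(U) = Δ′_a(U)⁻¹`, `Q′G′²Q′*`, `C = (Q′G′²Q′*)⁻¹`, `R(U)` (3.25), `H′ = G′²Q′*C` ([B8] (1.91)), `η²G′` — is assembled from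
# the conjugations `R(U(Γ))X = U(Γ)XU(Γ)⁻¹` and real scalar kernels, hence commutes with every FIBREWISE linear map that commutes with all `R(u)`;
# for `φ_τ(a) = τ(a)·1`, `τ` a trace (`τ(xy) = τ(yx)`), this is the `τ`-law of `B8Thm2TorusLetters.LettersTau`: `τ`-free in ⇒ `τ`-free out
# (junction J-B file 21 — the `gp_tau ∕ hp_tau ∕ r_tau` laws at ANY site transporter `parS`, in particular at print's transporters `parKnitY`)

statement-level skeleton of published theorems with citation tags; proofs where landed; nothing here is a claim about the
Yang–Mills mass gap

THE PRINT.  [B9] = [Balaban1985BackgroundPropagators] p. 389: *«U, with values in a compact Lie group G ⊂ U(N), is represented as U(x, x′) =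
exp iηA(x, x′), where … A is a configuration with values in the Lie algebra 𝔤 of the group G»*; p. 390: *«Let us recall that R(U)X = UXU⁻¹. This
operation will be widely used in this paper»*, and (3.3) p. 390–391 `(D_{U,μ}λ)(x) = η⁻¹(R(U(x, x+ηe_μ))λ(x+ηe_μ) − λ(x))`; p. 399 (Thm 3.3): *«λ replaced by
a function J defined at bonds of the lattice T_η or Ω₀, and with values in 𝔤»*.  [B8] = [Balaban1985RegularSpaces] p. 76: *«A is a Lie algebra valued
configuration»*; p. 93: *«we consider configurations λ with values in the complexified algebra. The function g maps the domain (1.102) into itself»*;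
p. 101: *«f is … a Lie algebra valued function defined on Ω₀ and satisfying R(U₀)f = f»*.  Print never states «the letters map 𝔤-valued functions to
𝔤-valued functions» as a numbered result: it is the standing convention under which (3.23)–(3.25) and [B8] (1.91)–(1.98) are written, and it holds
because every letter is built from `R(U(Γ)) = Ad U(Γ)` (which preserves `𝔤`) and real scalar kernels.  The tree's consumer states it as the three laws
of `B8Thm2TorusLetters.LettersTau τ` (for `𝔤 = 𝔰𝔲(N)`: `τ` = the trace, `𝔤`-valued = `τ`-free): `gp_tau` (G′), `hp_tau` (H′), `r_tau` (R).

WHY THIS FILE (cell context).  Sub-row G-B9-LETTERS, junction J-B (seat p33): files 1–20 supplied the ESTIMATE and SYMMETRY laws of `LettersAt` at the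
knit letter `parKnitY`; the (T)-presentation consumer (`Prop7Thm2OfLettersT3.hThm2_of_lettersPer_T3`, ym-inputs-p08) also needs
`ℓPτ : LettersAllPerTau (trCLM (Fin 2)) ℓP`, i.e. `LettersTau` member by member.  This file proves the three `τ`-laws for def-Y's letters at EVERY site
transporter letter `parS` and every background `U` (no law on the transporters is needed — unlike gauge covariance, J-B file 14), by one mechanism.

WHAT IS PROVED (all `theorem`s, no `sorry`, no new definition).
* §0 `intw_self_ringInverse`: NODE 00's intertwining relation `Intw σ σ L L` (`L ∘ σ = σ ∘ L`) passes to `Ring.inverse L` WITHOUT invertibility of `σ`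
  (the structure map here, `φ.compLeft`, is not invertible; `Node00.Intw.ringInverse` needs `IsUnit σ`).
* §1 THE ENGINE for a fibrewise `ℂ`-linear `φ : 𝔸 →ₗ[ℂ] 𝔸` with `φ(R(u)a) = R(u)φ(a)` for all units `u`, acting on carriers as Mathlib's `φ.compLeft X`:
  `intw_compLeft_trLiftY` (every transported lift `(M♯_T Λ)(y) = Σ_x M(y,x)·R(T(y,x))Λ(x)`), `intw_compLeft_liftMatY` (flat lifts, no hypothesis),
  `intw_compLeft_kernelTrOpY`, `cdS_compLeft ∕ cdsS_compLeft ∕ intw_compLeft_lapSL` (the covariant Laplacian (3.23)).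
* §2 THE LETTERS, generic `parS`, `U`, and generic `G′`-slot `Gp` where def-Y has one: `intw_compLeft_deltaPrimeAY ∕ _QpY ∕ _QpsY ∕ _GpY ∕ _XY ∕ _XinvY ∕ _RY ∕
  _CY ∕ _Hprime`, and at the knit letter `intw_compLeft_GpKnitY` (the consumer's `η²G′`).
* §3 THE TRACE: for `τ : 𝔸 →L[ℂ] ℂ` with `hτ : ∀ x y, τ (x * y) = τ (y * x)` the map `φ_τ := Algebra.linearMap ℂ 𝔸 ∘ₗ τ` (`a ↦ τ(a)·1`) satisfies the
  engine's hypothesis (`tauMap_R`); `τ`-free functions are the kernel of `φ_τ.compLeft` (`compLeft_tauMap_eq_zero`, and conversely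
  `tau_eq_zero_of_compLeft_tauMap_eq_zero` for `[Nontrivial 𝔸]`); ★ `tau_apply_eq_zero_of_intw`: an operator intertwining `φ_τ.compLeft` maps `τ`-free
  to `τ`-free.
* §4 ★★★ THE LAWS (generic `parS`, `[Nontrivial 𝔸]`): `deltaPrimeAY_tau`, `QpY_tau`, `QpsY_tau`, `GpY_tau` (= `gp_tau`'s shape), `XY_tau`, `XinvY_tau`, `CY_tau`,
  `RY_tau` and `RY_tau'` (= `r_tau`'s shape `f − G′Q′*CQ′G′f`), `Hprime_tau` (= `hp_tau`'s shape `G′G′Q′*C Y`), and at the knit letter `GpKnitY_tau`,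
  `GpY_parKnitY_tau`, `Hprime_parKnitY_tau`, `RY_parKnitY_tau`.

MODEL ∕ DECLARED READINGS.  (M1) fibre any complete normed `ℂ`-algebra `𝔸` (matrices `M_N(ℂ)` for `GpKnitY`), transporters `𝔸ˣ`-valued, `R(V)X = VXV⁻¹`
(`B9Eq39Adjoint.R`); «`𝔤`-valued» is read as «`τ`-free» for a tracial functional `τ` (the consumer's `trCLM`), exactly as in `B8Thm2TorusLetters.LettersTau`
and the `B8…TraceFree` files.  (M2) inverses are `Ring.inverse`s (M3 of `Node00.OpsYDeltaA`): the laws hold unconditionally (a non-unit has inverse `0`).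
(M3) NOT HERE: any estimate; the Hermitian part of «`𝔤`-valued» (reality: `Node00.OpsYSectDReal`, J-B file 12); the bond-sector letters `G, 𝔾_D, …`.
HONEST SCOPE.  Exact finite-dimensional algebra; no inequality of the papers; NOT summit progress.  Consumers: the M5.9 assembler of `LettersAt ∕ LettersTau`
at the knit letter (RECORD-JB-g95.md), the (T) presentation (`LettersAllPerTau`).  A NEW file importing `Node00.OpsYGauge` (the `Intw` calculus, the
letters) and `B9Thm311PositivityKnitLetter` (`GpKnitY`, `parKnitY`); nothing landed is modified; junction J-B file 21, seat p33 gen 95, 2026-08-28.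
Net new unproved facts: 0.
-/

noncomputable section

namespace Literature.MathematicalPhysics.QuantumFieldTheory.Balaban1983to89.B9B8KnitLetterTau

open Node00 B6KLevelCensusIndexV1 B9Eq39Adjoint
open B9B8AveragingJunction (parKnitY)
open B9Thm311PositivityKnitLetter (GpKnitY)
open scoped Matrix

variable {d ℓ : ℕ} {hd : 1 ≤ d + 1} {hL : Odd (ℓ + 1) ∧ 1 < ℓ + 1} {b₀ b₁ : ℝ}
variable {𝔸 : Type} [NormedRing 𝔸] [NormedAlgebra ℂ 𝔸] [CompleteSpace 𝔸]

/-! ## §0 `Ring.inverse` closure of self-intertwining -/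

section Intertwine

variable {M : Type} [AddCommGroup M] [Module ℂ M] {σ : M →ₗ[ℂ] M}

/-- ★ if `Lσ = σL` then `L⁻¹σ = σL⁻¹` for the total `Ring.inverse` (unit case: conjugate `σL = Lσ` by `L⁻¹`; non-unit: both sides vanish) — no invertibility of
the structure map `σ` is needed when the SAME operator stands on both sides. [cite: Balaban1985BackgroundPropagators, p.395 (G′ = Δ′_a⁻¹), (3.25) p.394 ((Q′G′²Q′*)⁻¹), bookkeeping] -/
theorem intw_self_ringInverse {L : Module.End ℂ M} (h : Intw σ σ L L) : Intw σ σ (Ring.inverse L) (Ring.inverse L) := by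
  unfold Intw at *
  rw [← Module.End.mul_eq_comp, ← Module.End.mul_eq_comp] at h ⊢
  by_cases hu : IsUnit L
  · obtain ⟨u, rfl⟩ := hu
    rw [Ring.inverse_unit]
    exact (Commute.units_inv_left (u := u) (a := σ) h).eq
  · rw [Ring.inverse_non_unit _ hu, zero_mul, mul_zero]

end Intertwine

/-! ## §1 The engine: letters commute with fibrewise `R`-equivariant linear maps -/

section Engine

variable {X Y : Type} [Fintype X] [Fintype Y]
variable (φ : 𝔸 →ₗ[ℂ] 𝔸) (hφ : ∀ (u : 𝔸ˣ) (a : 𝔸), φ (R u a) = R u (φ a))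

omit [Fintype Y] [CompleteSpace 𝔸] in
include hφ in
/-- ★ **THE ENGINE**: a transported lift `(M♯_T Λ)(y) = Σ_x M(y,x)·R(T(y,x))Λ(x)` with a REAL kernel commutes with the fibrewise application of any `ℂ`-linear
`φ` commuting with every `R(u)` (print: the letters act on `𝔤`-valued functions because `R(U(Γ)) = Ad U(Γ)` preserves `𝔤`).
[cite: Balaban1985BackgroundPropagators, p.390 («R(U)X = UXU⁻¹»), (3.3) p.390, (3.19) p.393, (3.24) p.394] -/
theorem intw_compLeft_trLiftY (M : Matrix Y X ℝ) (T : Y → X → 𝔸ˣ) :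
    Intw (φ.compLeft X) (φ.compLeft Y) (trLiftY M T) (trLiftY M T) := by
  refine LinearMap.ext fun Λ => funext fun y => ?_
  show ∑ x, ((M y x : ℝ) : ℂ) • R (T y x) (φ (Λ x)) = φ (∑ x, ((M y x : ℝ) : ℂ) • R (T y x) (Λ x))
  rw [map_sum]
  refine Finset.sum_congr rfl fun x _ => ?_
  rw [map_smul, hφ]

omit [Fintype Y] [CompleteSpace 𝔸] in
/-- a FLAT lift of a real matrix commutes with every fibrewise linear map. [cite: Balaban1985BackgroundPropagators, p.395 (U = 1), (3.48) p.398 (the scalar weights), bookkeeping] -/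
theorem intw_compLeft_liftMatY (M : Matrix Y X ℝ) :
    Intw (φ.compLeft X) (φ.compLeft Y) (liftMatY 𝔸 M) (liftMatY 𝔸 M) := by
  refine LinearMap.ext fun Λ => funext fun y => ?_
  show ∑ x, ((M y x : ℝ) : ℂ) • φ (Λ x) = φ (∑ x, ((M y x : ℝ) : ℂ) • Λ x)
  rw [map_sum]
  refine Finset.sum_congr rfl fun x _ => ?_
  rw [map_smul]

omit [CompleteSpace 𝔸] in
include hφ in
/-- a transported KERNEL operator (square table) commutes with the fibrewise `φ`. [cite: Balaban1985BackgroundPropagators, (3.24) p.394] -/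
theorem intw_compLeft_kernelTrOpY (K : X → X → ℝ) (T : X → X → 𝔸ˣ) :
    Intw (φ.compLeft X) (φ.compLeft X) (kernelTrOpY K T) (kernelTrOpY K T) := by
  rw [kernelTrOpY_eq_trLiftY]
  exact intw_compLeft_trLiftY φ hφ _ _

end Engine

/-! ## §2 The letters of def-Y's family, at any site transporter `parS` -/

section Letters

variable (i : KIdx d ℓ hd hL b₀ b₁) (U : CfgY 𝔸 i) (φ : 𝔸 →ₗ[ℂ] 𝔸) (hφ : ∀ (u : 𝔸ˣ) (a : 𝔸), φ (R u a) = R u (φ a))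

include hφ in
/-- `∇_{U,μ}` (3.3) commutes with the fibrewise `φ`, pointwise. [cite: Balaban1985BackgroundPropagators, (3.3) p.390] -/
theorem cdS_compLeft (μ : Fin (d + 1)) (Φ : SiteY i → 𝔸) (z : SiteY i) : cdS i U μ (φ.compLeft (SiteY i) Φ) z = φ (cdS i U μ Φ z) := by
  simp only [cdS, B9Eq39Adjoint.covD, LinearMap.compLeft_apply, Function.comp_apply, map_sub, hφ]

include hφ in
/-- `∇*_{U,μ}` (3.8) commutes with the fibrewise `φ`, pointwise. [cite: Balaban1985BackgroundPropagators, (3.8) p.392] -/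
theorem cdsS_compLeft (μ : Fin (d + 1)) (Φ : SiteY i → 𝔸) (z : SiteY i) : cdsS i U μ (φ.compLeft (SiteY i) Φ) z = φ (cdsS i U μ Φ z) := by
  simp only [cdsS, B9Eq39Adjoint.covDstar, LinearMap.compLeft_apply, Function.comp_apply, map_sub, hφ]

include hφ in
/-- ★ the covariant Laplacian `Σ_μ ∇*_{U,μ}∇_{U,μ}` (3.23) commutes with the fibrewise `φ`. [cite: Balaban1985BackgroundPropagators, (3.23) p.394] -/
theorem intw_compLeft_lapSL : Intw (φ.compLeft (SiteY i)) (φ.compLeft (SiteY i)) (lapSL i U) (lapSL i U) := by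
  refine LinearMap.ext fun Φ => funext fun z => ?_
  show lapS i U (φ.compLeft (SiteY i) Φ) z = φ (lapS i U Φ z)
  have h : ∀ μ, cdS i U μ (φ.compLeft (SiteY i) Φ) = φ.compLeft (SiteY i) (cdS i U μ Φ) :=
    fun μ => funext fun w => cdS_compLeft i U φ hφ μ Φ w
  simp only [lapS, h, cdsS_compLeft i U φ hφ]
  exact (map_sum φ _ _).symm

include hφ in
/-- ★ `Δ′_a(U) = Σ_μ∇*∇ + (averaging kernel)` (3.24) commutes with the fibrewise `φ`, for every site transporter letter. [cite: Balaban1985BackgroundPropagators, (3.24) p.394] -/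
theorem intw_compLeft_deltaPrimeAY (parS : SiteParY 𝔸 i) :
    Intw (φ.compLeft (SiteY i)) (φ.compLeft (SiteY i)) (deltaPrimeAY i parS U) (deltaPrimeAY i parS U) := by
  unfold deltaPrimeAY
  exact (intw_compLeft_lapSL i U φ hφ).add (intw_compLeft_kernelTrOpY φ hφ _ _)

include hφ in
/-- `Q′(U)` (3.19) commutes with the fibrewise `φ` (site → block carriers). [cite: Balaban1985BackgroundPropagators, (3.19) p.393, (3.24) p.394] -/
theorem intw_compLeft_QpY (parS : SiteParY 𝔸 i) : Intw (φ.compLeft (SiteY i)) (φ.compLeft (BlkY i)) (QpY i parS U) (QpY i parS U) :=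
  intw_compLeft_trLiftY φ hφ _ _

include hφ in
/-- `Q′*(U)` commutes with the fibrewise `φ` (block → site carriers). [cite: Balaban1985BackgroundPropagators, (3.24)–(3.25) p.394] -/
theorem intw_compLeft_QpsY (parS : SiteParY 𝔸 i) : Intw (φ.compLeft (BlkY i)) (φ.compLeft (SiteY i)) (QpsY i parS U) (QpsY i parS U) :=
  intw_compLeft_trLiftY φ hφ _ _

include hφ in
/-- ★★ `G′(U) = Δ′_a(U)⁻¹` commutes with the fibrewise `φ` (§0: no invertibility needed on either side). [cite: Balaban1985BackgroundPropagators, p.395 (G′), Thm 3.2 p.398] -/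
theorem intw_compLeft_GpY (parS : SiteParY 𝔸 i) : Intw (φ.compLeft (SiteY i)) (φ.compLeft (SiteY i)) (GpY i parS U) (GpY i parS U) :=
  intw_self_ringInverse (intw_compLeft_deltaPrimeAY i U φ hφ parS)

include hφ in
/-- `(Q′G′²Q′*)(U)` commutes with the fibrewise `φ`, for any `G′`-slot that does. [cite: Balaban1985BackgroundPropagators, (3.25) p.394] -/
theorem intw_compLeft_XY (parS : SiteParY 𝔸 i) {Gp : SiteOpY 𝔸 i} (hGp : Intw (φ.compLeft (SiteY i)) (φ.compLeft (SiteY i)) (Gp U) (Gp U)) :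
    Intw (φ.compLeft (BlkY i)) (φ.compLeft (BlkY i)) (XY i parS Gp U) (XY i parS Gp U) :=
  (intw_compLeft_QpY i U φ hφ parS).comp (hGp.comp (hGp.comp (intw_compLeft_QpsY i U φ hφ parS)))

include hφ in
/-- ★★ `C(U) = (Q′G′²Q′*)⁻¹(U)` (lattice units) commutes with the fibrewise `φ`. [cite: Balaban1985BackgroundPropagators, (3.25) p.394, (3.48) p.398] -/
theorem intw_compLeft_XinvY (parS : SiteParY 𝔸 i) {Gp : SiteOpY 𝔸 i} (hGp : Intw (φ.compLeft (SiteY i)) (φ.compLeft (SiteY i)) (Gp U) (Gp U)) :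
    Intw (φ.compLeft (BlkY i)) (φ.compLeft (BlkY i)) (XinvY i parS Gp U) (XinvY i parS Gp U) :=
  intw_self_ringInverse (intw_compLeft_XY i U φ hφ parS hGp)

include hφ in
/-- ★★ the projection `R(U) = I − G′Q′*(Q′G′²Q′*)⁻¹Q′G′` (3.25) commutes with the fibrewise `φ`. [cite: Balaban1985BackgroundPropagators, (3.25) p.394] -/
theorem intw_compLeft_RY (parS : SiteParY 𝔸 i) {Gp : SiteOpY 𝔸 i} (hGp : Intw (φ.compLeft (SiteY i)) (φ.compLeft (SiteY i)) (Gp U) (Gp U)) :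
    Intw (φ.compLeft (SiteY i)) (φ.compLeft (SiteY i)) (RY i parS Gp U) (RY i parS Gp U) :=
  Intw.id.sub (hGp.comp ((intw_compLeft_QpsY i U φ hφ parS).comp ((intw_compLeft_XinvY i U φ hφ parS hGp).comp
    ((intw_compLeft_QpY i U φ hφ parS).comp hGp))))

include hφ in
/-- `C(U)` in print's units (def-Y's `CY`, a real diagonal weight after `(Q′G′²Q′*)⁻¹`) commutes with the fibrewise `φ`. [cite: Balaban1985BackgroundPropagators, (3.48) p.398, (3.25) p.394] -/
theorem intw_compLeft_CY (parS : SiteParY 𝔸 i) {Gp : SiteOpY 𝔸 i} (hGp : Intw (φ.compLeft (SiteY i)) (φ.compLeft (SiteY i)) (Gp U) (Gp U)) :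
    Intw (φ.compLeft (BlkY i)) (φ.compLeft (BlkY i)) (CY i parS Gp U) (CY i parS Gp U) :=
  (intw_compLeft_XinvY i U φ hφ parS hGp).comp (intw_compLeft_liftMatY φ _)

include hφ in
/-- ★★ [B8] (1.91)'s `H′ = G′²Q′*(Q′G′²Q′*)⁻¹` commutes with the fibrewise `φ`. [cite: Balaban1985RegularSpaces, (1.91) p.91; Balaban1985BackgroundPropagators, (3.25) p.394] -/
theorem intw_compLeft_Hprime (parS : SiteParY 𝔸 i) {Gp : SiteOpY 𝔸 i} (hGp : Intw (φ.compLeft (SiteY i)) (φ.compLeft (SiteY i)) (Gp U) (Gp U)) :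
    Intw (φ.compLeft (BlkY i)) (φ.compLeft (SiteY i)) (Gp U ∘ₗ Gp U ∘ₗ QpsY i parS U ∘ₗ XinvY i parS Gp U)
      (Gp U ∘ₗ Gp U ∘ₗ QpsY i parS U ∘ₗ XinvY i parS Gp U) :=
  hGp.comp (hGp.comp ((intw_compLeft_QpsY i U φ hφ parS).comp (intw_compLeft_XinvY i U φ hφ parS hGp)))

end Letters

section KnitLetter

open scoped Matrix.Norms.L2Operator

variable {N : ℕ} (i : KIdx d ℓ hd hL b₀ b₁) (U : CfgY (Matrix (Fin N) (Fin N) ℂ) i)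
  (φ : Matrix (Fin N) (Fin N) ℂ →ₗ[ℂ] Matrix (Fin N) (Fin N) ℂ) (hφ : ∀ (u : (Matrix (Fin N) (Fin N) ℂ)ˣ) (a : Matrix (Fin N) (Fin N) ℂ), φ (R u a) = R u (φ a))

include hφ in
/-- the consumer's `η²G′(U)` at the knit letter (`GpKnitY`) commutes with the fibrewise `φ`. [cite: Balaban1985BackgroundPropagators, p.395 (G′); Balaban1985RegularSpaces, (1.95) p.92] -/
theorem intw_compLeft_GpKnitY (η : ℝ) : Intw (φ.compLeft (SiteY i)) (φ.compLeft (SiteY i)) (GpKnitY i η U) (GpKnitY i η U) :=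
  (intw_compLeft_GpY i U φ hφ (parKnitY i)).smul _

end KnitLetter

/-! ## §3 The trace: `φ_τ(a) = τ(a)·1` and the `τ`-free functions -/

section Tau

variable (τ : 𝔸 →L[ℂ] ℂ)

omit [CompleteSpace 𝔸] in
/-- `φ_τ(a) = τ(a)·1`, evaluated. [cite: Balaban1985RegularSpaces, p.76 (Lie algebra valued), bookkeeping] -/
theorem tauMap_apply (a : 𝔸) : (Algebra.linearMap ℂ 𝔸 ∘ₗ (τ : 𝔸 →ₗ[ℂ] ℂ)) a = algebraMap ℂ 𝔸 (τ a) := rfl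

omit [CompleteSpace 𝔸] in
/-- ★ for a TRACE (`τ(xy) = τ(yx)`), `φ_τ` commutes with every conjugation `R(u)`: `τ(uau⁻¹)·1 = τ(a)·1 = u(τ(a)·1)u⁻¹`.
[cite: Balaban1985BackgroundPropagators, p.390 («R(U)X = UXU⁻¹»); Balaban1985RegularSpaces, p.76] -/
theorem tauMap_R (hτ : ∀ x y : 𝔸, τ (x * y) = τ (y * x)) (u : 𝔸ˣ) (a : 𝔸) :
    (Algebra.linearMap ℂ 𝔸 ∘ₗ (τ : 𝔸 →ₗ[ℂ] ℂ)) (R u a) = R u ((Algebra.linearMap ℂ 𝔸 ∘ₗ (τ : 𝔸 →ₗ[ℂ] ℂ)) a) := by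
  have h1 : τ (R u a) = τ a := by
    rw [R_def, hτ, ← mul_assoc, Units.inv_mul, one_mul]
  have h2 : ∀ c : ℂ, R u (algebraMap ℂ 𝔸 c) = algebraMap ℂ 𝔸 c := fun c => by
    rw [R_def, ← Algebra.commutes, mul_assoc, Units.mul_inv, mul_one]
  rw [tauMap_apply, tauMap_apply, h1, h2]

omit [CompleteSpace 𝔸] in
/-- a `τ`-free function is killed by `φ_τ.compLeft`. [cite: Balaban1985RegularSpaces, p.76, bookkeeping] -/
theorem compLeft_tauMap_eq_zero {X : Type} {Λ : X → 𝔸} (hΛ : ∀ x, τ (Λ x) = 0) :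
    (Algebra.linearMap ℂ 𝔸 ∘ₗ (τ : 𝔸 →ₗ[ℂ] ℂ)).compLeft X Λ = 0 := by
  funext x
  show algebraMap ℂ 𝔸 (τ (Λ x)) = 0
  rw [hΛ, map_zero]

omit [CompleteSpace 𝔸] in
/-- conversely (nontrivial fibre: `algebraMap ℂ 𝔸` is injective), the kernel of `φ_τ.compLeft` consists of `τ`-free functions. [cite: Balaban1985RegularSpaces, p.76, bookkeeping] -/
theorem tau_eq_zero_of_compLeft_tauMap_eq_zero [Nontrivial 𝔸] {X : Type} {Λ : X → 𝔸}
    (h : (Algebra.linearMap ℂ 𝔸 ∘ₗ (τ : 𝔸 →ₗ[ℂ] ℂ)).compLeft X Λ = 0) (x : X) : τ (Λ x) = 0 := by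
  have hx := congr_fun h x
  change algebraMap ℂ 𝔸 (τ (Λ x)) = 0 at hx
  exact (map_eq_zero_iff _ (algebraMap ℂ 𝔸).injective).1 hx

omit [CompleteSpace 𝔸] in
/-- ★ **EXTRACTION**: an operator intertwining `φ_τ.compLeft` on its carriers maps `τ`-free functions to `τ`-free functions.
[cite: Balaban1985RegularSpaces, p.76, p.93 («maps the domain (1.102) into itself»); Balaban1985BackgroundPropagators, p.399 (Thm 3.3, «with values in 𝔤»)] -/
theorem tau_apply_eq_zero_of_intw [Nontrivial 𝔸] {X Y : Type} {T : (X → 𝔸) →ₗ[ℂ] (Y → 𝔸)}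
    (h : Intw ((Algebra.linearMap ℂ 𝔸 ∘ₗ (τ : 𝔸 →ₗ[ℂ] ℂ)).compLeft X) ((Algebra.linearMap ℂ 𝔸 ∘ₗ (τ : 𝔸 →ₗ[ℂ] ℂ)).compLeft Y) T T)
    {Λ : X → 𝔸} (hΛ : ∀ x, τ (Λ x) = 0) (y : Y) : τ (T Λ y) = 0 := by
  refine tau_eq_zero_of_compLeft_tauMap_eq_zero τ ?_ y
  rw [← h.apply, compLeft_tauMap_eq_zero τ hΛ, map_zero]

end Tau

/-! ## §4 The `τ`-laws of the letters (`LettersTau`'s `gp_tau ∕ hp_tau ∕ r_tau` shapes), generic `parS` -/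

section Laws

variable [Nontrivial 𝔸] (τ : 𝔸 →L[ℂ] ℂ) (hτ : ∀ x y : 𝔸, τ (x * y) = τ (y * x))
variable (i : KIdx d ℓ hd hL b₀ b₁) (parS : SiteParY 𝔸 i) (U : CfgY 𝔸 i)
include hτ

/-- `Δ′_a(U)` maps `τ`-free to `τ`-free. [cite: Balaban1985BackgroundPropagators, (3.24) p.394, p.389 (values in 𝔤)] -/
theorem deltaPrimeAY_tau {Λ : SiteY i → 𝔸} (hΛ : ∀ z, τ (Λ z) = 0) (z : SiteY i) : τ (deltaPrimeAY i parS U Λ z) = 0 :=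
  tau_apply_eq_zero_of_intw τ (intw_compLeft_deltaPrimeAY i U _ (tauMap_R τ hτ) parS) hΛ z

/-- `Q′(U)` maps `τ`-free site functions to `τ`-free block functions. [cite: Balaban1985BackgroundPropagators, (3.19) p.393] -/
theorem QpY_tau {Λ : SiteY i → 𝔸} (hΛ : ∀ z, τ (Λ z) = 0) (s : BlkY i) : τ (QpY i parS U Λ s) = 0 :=
  tau_apply_eq_zero_of_intw τ (intw_compLeft_QpY i U _ (tauMap_R τ hτ) parS) hΛ s

/-- `Q′*(U)` maps `τ`-free block functions to `τ`-free site functions. [cite: Balaban1985BackgroundPropagators, (3.24)–(3.25) p.394] -/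
theorem QpsY_tau {Y : BlkY i → 𝔸} (hY : ∀ s, τ (Y s) = 0) (z : SiteY i) : τ (QpsY i parS U Y z) = 0 :=
  tau_apply_eq_zero_of_intw τ (intw_compLeft_QpsY i U _ (tauMap_R τ hτ) parS) hY z

/-- ★★★ **`gp_tau`**: `G′(U) = Δ′_a(U)⁻¹` maps `τ`-free to `τ`-free, at every site transporter letter and every background. [cite: Balaban1985BackgroundPropagators, p.395 (G′), Thm 3.2 p.398, p.399 («with values in 𝔤»); Balaban1985RegularSpaces, p.76, (1.95) p.92] -/
theorem GpY_tau {Λ : SiteY i → 𝔸} (hΛ : ∀ z, τ (Λ z) = 0) (z : SiteY i) : τ (GpY i parS U Λ z) = 0 :=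
  tau_apply_eq_zero_of_intw τ (intw_compLeft_GpY i U _ (tauMap_R τ hτ) parS) hΛ z

/-- `(Q′G′²Q′*)(U)` maps `τ`-free to `τ`-free. [cite: Balaban1985BackgroundPropagators, (3.25) p.394] -/
theorem XY_tau {Y : BlkY i → 𝔸} (hY : ∀ s, τ (Y s) = 0) (s : BlkY i) : τ (XY i parS (GpY i parS) U Y s) = 0 :=
  tau_apply_eq_zero_of_intw τ (intw_compLeft_XY i U _ (tauMap_R τ hτ) parS (intw_compLeft_GpY i U _ (tauMap_R τ hτ) parS)) hY s

/-- ★★ `C(U) = (Q′G′²Q′*)⁻¹(U)` maps `τ`-free to `τ`-free. [cite: Balaban1985BackgroundPropagators, (3.25) p.394, (3.48) p.398] -/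
theorem XinvY_tau {Y : BlkY i → 𝔸} (hY : ∀ s, τ (Y s) = 0) (s : BlkY i) : τ (XinvY i parS (GpY i parS) U Y s) = 0 :=
  tau_apply_eq_zero_of_intw τ (intw_compLeft_XinvY i U _ (tauMap_R τ hτ) parS (intw_compLeft_GpY i U _ (tauMap_R τ hτ) parS)) hY s

/-- `C(U)` in print's units (def-Y's `CY`) maps `τ`-free to `τ`-free. [cite: Balaban1985BackgroundPropagators, (3.48) p.398] -/
theorem CY_tau {Y : BlkY i → 𝔸} (hY : ∀ s, τ (Y s) = 0) (s : BlkY i) : τ (CY i parS (GpY i parS) U Y s) = 0 :=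
  tau_apply_eq_zero_of_intw τ (intw_compLeft_CY i U _ (tauMap_R τ hτ) parS (intw_compLeft_GpY i U _ (tauMap_R τ hτ) parS)) hY s

/-- ★★★ **`r_tau`**: the projection `R(U)` (3.25) maps `τ`-free to `τ`-free. [cite: Balaban1985BackgroundPropagators, (3.25) p.394; Balaban1985RegularSpaces, (1.98) p.92, p.101 («R(U₀)f = f», Lie algebra valued)] -/
theorem RY_tau {Λ : SiteY i → 𝔸} (hΛ : ∀ z, τ (Λ z) = 0) (z : SiteY i) : τ (RY i parS (GpY i parS) U Λ z) = 0 :=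
  tau_apply_eq_zero_of_intw τ (intw_compLeft_RY i U _ (tauMap_R τ hτ) parS (intw_compLeft_GpY i U _ (tauMap_R τ hτ) parS)) hΛ z

omit [Nontrivial 𝔸] hτ in
/-- `R(U)f = f − G′Q′*CQ′G′f`, evaluated. [cite: Balaban1985BackgroundPropagators, (3.25) p.394, bookkeeping] -/
theorem RY_apply_eq (Gp : SiteOpY 𝔸 i) (Λ : SiteY i → 𝔸) :
    RY i parS Gp U Λ = Λ - Gp U (QpsY i parS U (XinvY i parS Gp U (QpY i parS U (Gp U Λ)))) := rfl

/-- ★★★ **`r_tau` in the consumer's spelling** `f − G′(Q′*(C(Q′(G′f))))`. [cite: Balaban1985BackgroundPropagators, (3.25) p.394; Balaban1985RegularSpaces, (1.98) p.92] -/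
theorem RY_tau' {Λ : SiteY i → 𝔸} (hΛ : ∀ z, τ (Λ z) = 0) (z : SiteY i) :
    τ ((Λ - GpY i parS U (QpsY i parS U (XinvY i parS (GpY i parS) U (QpY i parS U (GpY i parS U Λ))))) z) = 0 := by
  have h := RY_tau τ hτ i parS U hΛ z
  rw [RY_apply_eq] at h
  exact h

/-- ★★★ **`hp_tau`**: [B8] (1.91)'s `H′ = G′²Q′*C` maps `τ`-free block functions to `τ`-free configurations. [cite: Balaban1985RegularSpaces, (1.91) p.91, p.76; Balaban1985BackgroundPropagators, (3.25) p.394] -/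
theorem Hprime_tau {Y : BlkY i → 𝔸} (hY : ∀ s, τ (Y s) = 0) (z : SiteY i) :
    τ (GpY i parS U (GpY i parS U (QpsY i parS U (XinvY i parS (GpY i parS) U Y))) z) = 0 :=
  tau_apply_eq_zero_of_intw τ (intw_compLeft_Hprime i U _ (tauMap_R τ hτ) parS (intw_compLeft_GpY i U _ (tauMap_R τ hτ) parS)) hY z

end Laws

section KnitLaws

open scoped Matrix.Norms.L2Operator

variable {N : ℕ} (τ : Matrix (Fin N) (Fin N) ℂ →L[ℂ] ℂ) (hτ : ∀ x y : Matrix (Fin N) (Fin N) ℂ, τ (x * y) = τ (y * x))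
variable (i : KIdx d ℓ hd hL b₀ b₁) (U : CfgY (Matrix (Fin N) (Fin N) ℂ) i)
include hτ

/-- ★★★ `gp_tau` AT THE KNIT LETTER for the consumer's `η²G′(U; parKnitY)` (`N ≥ 1`). [cite: Balaban1985BackgroundPropagators, p.395 (G′), (3.19) p.393; Balaban1985RegularSpaces, (1.95) p.92, p.76] -/
theorem GpKnitY_tau [Nonempty (Fin N)] (η : ℝ) {Λ : SiteY i → Matrix (Fin N) (Fin N) ℂ} (hΛ : ∀ z, τ (Λ z) = 0) (z : SiteY i) :
    τ (GpKnitY i η U Λ z) = 0 :=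
  tau_apply_eq_zero_of_intw τ (intw_compLeft_GpKnitY i U _ (tauMap_R τ hτ) η) hΛ z

/-- `gp_tau` at the knit letter, lattice units. [cite: Balaban1985BackgroundPropagators, p.395 (G′), (3.19) p.393] -/
theorem GpY_parKnitY_tau [Nonempty (Fin N)] {Λ : SiteY i → Matrix (Fin N) (Fin N) ℂ} (hΛ : ∀ z, τ (Λ z) = 0) (z : SiteY i) :
    τ (GpY i (parKnitY i) U Λ z) = 0 :=
  GpY_tau τ hτ i (parKnitY i) U hΛ z

/-- `hp_tau` at the knit letter. [cite: Balaban1985RegularSpaces, (1.91) p.91; Balaban1985BackgroundPropagators, (3.25) p.394] -/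
theorem Hprime_parKnitY_tau [Nonempty (Fin N)] {Y : BlkY i → Matrix (Fin N) (Fin N) ℂ} (hY : ∀ s, τ (Y s) = 0) (z : SiteY i) :
    τ (GpY i (parKnitY i) U (GpY i (parKnitY i) U (QpsY i (parKnitY i) U (XinvY i (parKnitY i) (GpY i (parKnitY i)) U Y))) z) = 0 :=
  Hprime_tau τ hτ i (parKnitY i) U hY z

/-- `r_tau` at the knit letter. [cite: Balaban1985BackgroundPropagators, (3.25) p.394; Balaban1985RegularSpaces, (1.98) p.92] -/
theorem RY_parKnitY_tau [Nonempty (Fin N)] {Λ : SiteY i → Matrix (Fin N) (Fin N) ℂ} (hΛ : ∀ z, τ (Λ z) = 0) (z : SiteY i) :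
    τ (RY i (parKnitY i) (GpY i (parKnitY i)) U Λ z) = 0 :=
  RY_tau τ hτ i (parKnitY i) U hΛ z

end KnitLaws

end Literature.MathematicalPhysics.QuantumFieldTheory.Balaban1983to89.B9B8KnitLetterTau

end
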